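import Summits.AtomisticToContinuum.FouriersLaw.Theses.CageBudgetFekete
import Summits.AtomisticToContinuum.FouriersLaw.Theorems.CoercivePulseLinearCeilingOfUniformAbelianRegularity
import Summits.AtomisticToContinuum.FouriersLaw.Theorems.AbelThermodynamicLimitSharedConeOfRegularity
import Summits.AtomisticToContinuum.FouriersLaw.Theorems.CurrentTiltQuenchSymmetricSetup
import Summits.AtomisticToContinuum.FouriersLaw.Theorems.CageBudgetFeketeHeatVarianceCalculus
import HarnessLib

/-!
# `HeatVarianceCeiling` from the route's own (R) — regularity collapse of the ceiling crux
(crux `CageBudgetFekete.HeatVarianceCeiling`, item stmt-AtomisticToContinuum-15770; `--supports` file: it closes nothing,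
it REDUCES the crux to the existing shared item stmt-AtomisticToContinuum-13416; crux-strategist p1, 2026-08-17)

WHAT. `heatVarianceCeiling_of_uniformAbelianRegularity : UniformAbelianRegularity → HeatVarianceCeiling`
(hypothesis = the route decl `CageBudgetFekete.UniformAbelianRegularity`, item stmt-13416, child of the split
`AbelThermodynamicLimit` and shared verbatim with CoercivePulse / EmbeddedDrudeMourre / HoelderEscapeProfile /
StaticAbelianSqueeze; conclusion = the crux decl, the LINEAR CEILING `V_T(τ) ≤ B·τ` of the equilibrium heat variance
of the closed infinite chain). With this theorem the crux `HeatVarianceCeiling` carries no mathematical content beyond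
(R): it closes the moment stmt-13416 closes. Consequently the route's honest open cone is `{Q, U, R}`:
`fouriersLaw_of_heatVarianceBets_and_regularity : QuasiSuperadditiveHeatVariance → UnboundedHeatVariance →
UniformAbelianRegularity → FouriersLaw` (SymmetricSetup and HeatVarianceCalculus are proved in tree).

HOW (every ingredient is a landed theorem of namespace `…Theorems.LinearCeiling.SpikeLemma`). For a symmetric pair
`(μ, D)` of `pinnedChain ω₂ lam β γ` at `T` (μ the shift- and reversal-invariant DLR state, `D` ANY `μ`-preserving
dynamics):
(1) `stub_abelMeanCeiling`: (R) ⇒ `Â(ν) = ∫₀^∞ e^{−νt} C_T(t) dt ≤ B` for `ν ∈ (0, ν₀)` ((R) at ε = 1 and bath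
    constant 1, fixed-frequency open/closed matching for the canonical Buttà–Marchioro twin);
(2) `stub_spectralRepresentation`: `C_T(t) = ∫ cos(ωt) dσ(ω)` for a finite measure `σ`;
(3) `stub_envelopeOfSpectralAbelBound` (pure real analysis): (1) + (2) ⇒ `2∫₀^τ (τ−u) C_T(u) du ≤ b·τ` for `τ ≥ 0`,
    with `b = 8·max(B,0) + 2σ(ℝ)/ν₀` (Fejér kernel ≤ 8t·(Abel kernel at ν = 1/t)).
Hence `V_T(τ) ≤ b·τ` for every `τ ≥ 0`: the crux with `τ₁ = 0`. The shift-covariance, absolute-convergence and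
continuity binders of the crux are idle here (consistent with `Disproof.heatVarianceCeiling_iff_core`).
-/

noncomputable section

namespace Summit.AtomisticToContinuum.FouriersLaw.Theorems.HeatVarianceCeiling.RegularityCollapse

open MeasureTheory Filter Set
open scoped Topology BigOperators

/-- **`HeatVarianceCeiling` is a consequence of the route's own (R).** For the pinned anharmonic chain, N-uniform
Abelian regularity of the open chain's equilibrium current autocorrelation (`CageBudgetFekete.UniformAbelianRegularity`,
item stmt-AtomisticToContinuum-13416) implies the linear ceiling of the equilibrium heat variance of every symmetric pair
(`CageBudgetFekete.HeatVarianceCeiling`, item stmt-AtomisticToContinuum-15770), with anchor `τ₁ = 0`.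
Over landed theorems only (three stubs of line `SpikeLemma` of the sibling crux `CoercivePulse.LinearCeiling`).
[cite: BonettoLebowitzReyBellet2000, §7] [cite: Helfand1960, §II] -/
theorem heatVarianceCeiling_of_uniformAbelianRegularity :
    _root_.Summit.AtomisticToContinuum.FouriersLaw.Theses.CageBudgetFekete.UniformAbelianRegularity →
    _root_.Summit.AtomisticToContinuum.FouriersLaw.Theses.CageBudgetFekete.HeatVarianceCeiling := by
  intro hR ω₂ lam β γ hω hl hβ T hT μ hG hSI hRv D hP _hSh _hAC _hCc V hV
  have hR' : _root_.Summit.AtomisticToContinuum.FouriersLaw.Theses.CoercivePulse.UniformAbelianRegularity := hR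
  obtain ⟨B, ν₀, hν₀, hA⟩ :=
    Summit.AtomisticToContinuum.FouriersLaw.Theorems.LinearCeiling.SpikeLemma.stub_abelMeanCeiling
      hR' ω₂ lam β γ hω hl hβ T hT μ hG hSI hRv D hP
  obtain ⟨σ, hσ, hC⟩ :=
    Summit.AtomisticToContinuum.FouriersLaw.Theorems.LinearCeiling.SpikeLemma.stub_spectralRepresentation
      ω₂ lam β γ hω hl hβ T hT μ hG hSI hRv D hP
  obtain ⟨b, hb⟩ :=
    Summit.AtomisticToContinuum.FouriersLaw.Theorems.LinearCeiling.SpikeLemma.stub_envelopeOfSpectralAbelBound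
      σ hσ _ hC B ν₀ hν₀ hA
  refine ⟨b, 0, fun τ hτ => ?_⟩
  subst hV
  exact hb τ hτ

/-- The same reduction stated against the sibling route's copy of (R) (`CoercivePulse.UniformAbelianRegularity`, the decl
the landed engine tree of stmt-13416 concludes): the two copies are the same term. -/
theorem heatVarianceCeiling_of_uniformAbelianRegularity' :
    _root_.Summit.AtomisticToContinuum.FouriersLaw.Theses.CoercivePulse.UniformAbelianRegularity →
    _root_.Summit.AtomisticToContinuum.FouriersLaw.Theses.CageBudgetFekete.HeatVarianceCeiling :=
  fun hR => heatVarianceCeiling_of_uniformAbelianRegularity hR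

/-- **The route's open cone is `{Q, U, R}`.** On route CageBudgetFekete, Fourier's law follows from the two genuinely
route-specific bets — Fekete quasi-superadditivity (Q) and unboundedness (U) of the equilibrium heat variance — together
with the shared regularity crux (R); the ceiling (C) is discharged by `heatVarianceCeiling_of_uniformAbelianRegularity`,
`SymmetricSetup` and `HeatVarianceCalculus` are proved in tree, and `AbelThermodynamicLimit` is discharged by the shared
cone theorem `fouriersLaw_of_cageEngine_and_regularity`. -/
theorem fouriersLaw_of_heatVarianceBets_and_regularity
    (hQ : _root_.Summit.AtomisticToContinuum.FouriersLaw.Theses.CageBudgetFekete.QuasiSuperadditiveHeatVariance)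
    (hU : _root_.Summit.AtomisticToContinuum.FouriersLaw.Theses.CageBudgetFekete.UnboundedHeatVariance)
    (hR : _root_.Summit.AtomisticToContinuum.FouriersLaw.Theses.CageBudgetFekete.UniformAbelianRegularity) :
    _root_.FouriersLaw :=
  Summit.AtomisticToContinuum.FouriersLaw.Theorems.AbelThermodynamicLimit.SharedCone.fouriersLaw_of_cageEngine_and_regularity
    Summit.AtomisticToContinuum.FouriersLaw.Theorems.CurrentTiltQuench.cageBudgetFekete_symmetricSetup_proof
    Summit.AtomisticToContinuum.FouriersLaw.Theorems.HeatVarianceCalculus.CanonicalRigidity.heatVarianceCalculus_proof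
    hQ (heatVarianceCeiling_of_uniformAbelianRegularity hR) hU hR

end Summit.AtomisticToContinuum.FouriersLaw.Theorems.HeatVarianceCeiling.RegularityCollapse

end
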